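import Literature.MathematicalPhysics.QuantumFieldTheory.Balaban1983to89.HaarDist1LevelHypersurface
import Summits.QuantumFields.YangMills.Theorems.BalabanUVNodesN09HregOfPerBondChartsAtRecord

/-!
# NODE N09 [B12] · (F2) ON THE FIBRE COORDINATES — THE EXACT (2.9) THRESHOLDS ARE NULL ALONG EVERY CHART THAT LEAVES THE NON-DISTINGUISHED BOND
# VARIABLES HAAR-FREE; in particular OUTRIGHT (w.r.t. `fieldMeasure`) along road A′'s private-coordinate chart `extend centralBond …` and its
# χ-support re-basing: the `hnull` binder of the (F1) tower at that chart, and the nullity third of road A′'s `hgc`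

Cell `pub-ymgap` (YM-PLAN Track A), DAG node N09 [Balaban1987RG1] (= [I]); width seat `pub-ymgap-dag-n09-w3` g5 (D-0149 width seat 3 of node N09);
count-neutral helper keyed to K1⁹ `StabilityBRunRowsAtRecordR13SepCoPHV` = stmt-QuantumFields-27364 (`--kind proof --supports … --as helper`; KEY MAP v2; lineage of
this seat's K1⁷-keyed p607548 `HaarDist1LevelHypersurface` ∕ p609535 `…N09ContourThresholdNull`).  Species (a) «analytic fibre charts» of the same nullity is
dag-n09-w1 g5's `…N09FibreThresholdNullOfAnalyticChart` (CLAIM-8 I.35708, first claim; this seat's CLAIM-1 I.35727 DECL-DELTA-1 I.35886) — NOT restated here.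

WHY.  The (F1) tower of dag-n09-w1 g5 (`…N09FibreIntegralContinuousOfChartRegularity` → `…N09OnDomainProvisoOfGeometricChartData`, p617606 … p622863) turns the
analytic inclusion `hreg` of the N09 doors into a theorem of PER-STEP FIBRED-CHART DATA `(Z j, τ j, Φ j, J j, z₀ j)` of the averaging of record; among its displayed
A-free regularity binders is `hnull : ∀ j < K, ∀ V₀ ∈ domAlt_{j+1}, ∀ b, ¬IsB0 b → τ j {z | fluctDevOfRecord ν K j (Φ j (V₀, z)) b = ε₁} = 0` — «the exact (2.9)
thresholds are null on the fibre coordinates» (dag-n09-w6 g2's `Node00.FibreIntegralMovingThreshold` §3 = the nullity third of road A′'s `hgc`; the FIBRE species of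
the P7 locator's (F2)).  dag-n09-w1 g4's `…N09FibreThresholdNullAE` gives the sentence for `dŪ`-ALMOST EVERY coarse field; the tower needs it AT EVERY `V₀`.
THIS FILE supplies it at every `V₀` for the charts that leave a bond variable HAAR-FREE, from the structure of the (2.9) deviation alone: ON THE FIBRE over `V₀`
(the chart datum `havgΦ : Ū(Φ(V₀,z)) = V₀`) the critical configuration `V^{(j)}(Ū)` is the CONSTANT `V^{(j)}(V₀)`, so the deviation at `b` is
`dist1 (V^{(j)}(V₀)(b)⁻¹ · Φ(V₀,z)(b))` (`fluctDevOfRecord_eq_of_avg_eq`) and the exact-threshold set is the preimage under `z ↦ Φ(V₀,z)(b)` of the TRANSLATED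
`dist1`-SPHERE `{g | dist1(h⁻¹g) = ε₁}`, `h = V^{(j)}(V₀)(b)` — Haar-null for `ε₁ ≠ 0` (p607548 §4 + left invariance).  So: if the law of `Φ(V₀,·)(b)` under `τ` is
`≪ Haar`, `hnull` holds at `(V₀, b)` (`hnull_of_haarFreeBond`).  THE TREE'S OWN ROAD-A′ CHART IS SUCH A CHART AT EVERY NON-DISTINGUISHED BOND: dag-n09-w6 g3's
`Φ(V₀,U) = extend centralBond (c ↦ ϑ c U (V₀ c)) U` (`…N09HregOfPerBondChartsAtRecord`, fibre space = the fine configurations, `τ = fieldMeasure`) replaces ONLY the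
central bonds, and the distinguished bonds `b₀(c)` excluded by (2.9) ARE the central bonds (both `line c ((L−1)∕2)`, definitionally) — so at `¬IsB0 b` the chart leaves
`U b` untouched and the threshold set is `dU`-NULL OUTRIGHT on the coarse-window support (`hright` alone; `…extendCentralBond_eq_zero` ∕ `…_of_jacobian`), and for
dag-n09-w5 g4's χ-SUPPORT RE-BASING `Φ′ = A.piecewise Φ (V^{(j)} ∘ fst)` (CLAIM-2 I.35785, the road-A′ instance of the tower: fallback = the critical configuration,
which lies in the fibre on the solvable set) the binder `hnull` holds VERBATIM over ALL `U` (`…piecewise…_eq_zero` ∕ `hnull_towerChart_of_perBondCharts`).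

WHAT IS PROVED (theorems only; 0 def, 0 instance, 0 notation, 0 sorry; axioms standard).
* §1 (translated spheres) `haar_setOf_dist1_inv_mul_eq_eq_zero` (`Haar{g ∈ SU(N) | dist1(h⁻¹g) = r} = 0`, `r ≠ 0`), `fieldMeasure_setOf_dist1_inv_mul_apply_eq_eq_zero`
  (`dU{U | dist1(h⁻¹·U b) = r} = 0`, Mathlib `Measure.pi_eval_preimage_null`), `measure_setOf_dist1_inv_mul_comp_eq_eq_zero_of_map_ac` (`π_*τ ≪ Haar`).
* §2 (at the record) `fluctDevOfRecord_eq_of_avg_eq`; ★★ `hnull_of_haarFreeBond` (ONE `(k, V₀, b)`: `havgΦ` off a `τ`-null set, `z ↦ Φ(V₀,z) b` measurable with law `≪ Haar`).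
* §3 (road A′) ★★ `fieldMeasure_thresholdSet_extendCentralBond_eq_zero` (`dU{U | (∀ c, V₀ c ∈ T c U) ∧ fluctDev_j(Φ(V₀,U))(b) = ε₁} = 0` for `¬IsB0 b`, `ε₁ ≠ 0`, from
  `hright` alone) ∕ ★★ `…_of_jacobian` (support `J(V₀,U) ≠ 0`); ★★★ `fieldMeasure_thresholdSet_piecewise_extendCentralBond_eq_zero` (the χ-support re-basing
  `Φ′ = A.piecewise Φ (V^{(j)} ∘ fst)`, any `A` inside `{J ≠ 0}` on the slice, `Ū(V^{(j)}(V₀)) = V₀`: the set over ALL `U` is `dU`-null); ★★★ `hnull_towerChart_of_perBondCharts`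
  (the tower's binder SHAPE `∀ j < K, ∀ V₀ ∈ domAlt_{j+1}, ∀ b, ¬IsB0 b → fieldMeasure {U | fluctDev_j(Φ′ j (V₀,U))(b) = ε₁} = 0` from per-step inversion data `(T, ϑ, jd; hright)`,
  re-basing sets `A j` inside `{J_j ≠ 0}`, [B11] solvability `hsolν` on the domains (for `Ū(V^{(j)}(V₀)) = V₀`, K0e's `avg_critCfgOfRecord`) and `0 < ε₁`).

HONEST SCOPE ∕ FRAMING.  LOCATED, count-neutral measure theory BY NAME ([BrockerTomDieck1985] IV (2.11) ∕ [Balaban1985Averaging] (19) through p607548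
`haar_setOf_dist1_mem_eq_zero_specialUnitaryGroup`; `HaarData.map_mul_left`; Mathlib `Measure.pi_eval_preimage_null`; dag-n09-w6 g3's `avOfRecord_triChart_eq_of_jacobian_ne_zero` ∕
`isLocal_avOfRecord` ∕ `centralBond_injective_record` and the generic `T4TriangularFibredChart.apply_triChart_eq_of_forall_mem` BY NAME).  ONE displayed binder of the (F1)
tower becomes a theorem AT THE ROAD-A′ CHARTS; the inversions `(Ω T ϑ jd; hright hlaw …)`, the other regularity binders (`hconf hΦV hJV hΦc hJpos`), `hφ`∕`hcrit` (N07), `hmap`,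
(181)ˢᵒˡ, (I19), [B11] ×3 and the numerics stay DISPLAYED wherever they are; road A′'s `hgc` is NOT discharged (its reduction
`continuousOn_fibreIntegral_betaInput_chiFixed29_of_thresholdNull` also asks a.e. continuity of the deviations and of the smooth factor); species (a) (analytic
charts, the (2.10) `ker Q` chart) is dag-n09-w1 g5's file, not here; NOTHING of Bałaban's asserted; no chart constructed; `hreg`∕`contTOn` NOT discharged; N09 NOT
discharged; conjunct 1 (Lemma 4) ∕ FLAG №7 untouched; K0⁷ ∕ K1⁹ ∕ K3⁸ NOT closed; counts unmoved (typed 28∕28 · discharged 5∕28); one finite four-torus programme at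
fixed `ε = L^{−K}` per run — R4 closes the conditional rung `BalabanLadder.UV` only; NOT ℝ⁴ ∕ infinite volume ∕ OS; the Yang–Mills mass gap (Clay) is NOT proved by
any of this.
-/

noncomputable section

open MeasureTheory Set Filter Topology Function
open scoped ENNReal NNReal Matrix.Norms.L2Operator
open Literature.MathematicalPhysics.QuantumFieldTheory
open Literature.MathematicalPhysics.QuantumFieldTheory.Balaban1983to89
open Literature.MathematicalPhysics.QuantumFieldTheory.Balaban1983to89.Node00
open Literature.MathematicalPhysics.QuantumFieldTheory.Balaban1983to89.T4Continuum (T4Family)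
open Literature.MathematicalPhysics.QuantumFieldTheory.Balaban1983to89.HaarDist1LevelHypersurface (haar_setOf_dist1_mem_eq_zero_specialUnitaryGroup)
open Literature.MathematicalPhysics.QuantumFieldTheory.Balaban1983to89.BlockAveragingHaarAC (centralBond)
open Literature.MathematicalPhysics.QuantumFieldTheory.Balaban1983to89.T4TriangularFibredChart (apply_triChart_eq_of_forall_mem)
open Summit.QuantumFields.YangMills.BalabanUVNodes.N09HregOfPerBondChartsAtRecord (isLocal_avOfRecord centralBond_injective_record
  avOfRecord_triChart_eq_of_jacobian_ne_zero)

namespace Summit.QuantumFields.YangMills.BalabanUVNodes.N09FibreThresholdNullOfCharts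

/-! ## §1 Translated `dist1`-spheres: in `SU(N)`, in one bond variable of a configuration, along Haar-free `SU(N)`-valued maps -/

section Spheres

variable {N : ℕ} [NeZero N]

/-- **`Haar{g ∈ SU(N) | dist1(h⁻¹·g) = r} = 0` for `r ≠ 0`** — the sphere of `dist1`-radius `r` centred at `h` (left translate of the centred sphere
`{dist1 = r}`, null by p607548 `haar_setOf_dist1_mem_eq_zero_specialUnitaryGroup`; Haar measure is left invariant).
[cite: Balaban1985Averaging, (19) p.21] [cite: BrockerTomDieck1985, IV (2.11) (proof)] -/
theorem haar_setOf_dist1_inv_mul_eq_eq_zero (h : SU N) {r : ℝ} (hr : r ≠ 0) :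
    (HaarData.haar : Measure (SU N)) {g : SU N | dist1 (h⁻¹ * g) = r} = 0 := by
  have hm : MeasurableSet {g : SU N | dist1 g ∈ ({r} : Set ℝ)} :=
    RegularGaugeGroup.measurable_dist1 (measurableSet_singleton r)
  have hset : {g : SU N | dist1 (h⁻¹ * g) = r} = (fun g : SU N => h⁻¹ * g) ⁻¹' {g : SU N | dist1 g ∈ ({r} : Set ℝ)} := by
    ext g
    simp only [mem_setOf_eq, mem_preimage, mem_singleton_iff]
  have hmul : Measurable fun g : SU N => h⁻¹ * g := (continuous_const.mul continuous_id).measurable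
  rw [hset, ← Measure.map_apply hmul hm, HaarData.map_mul_left]
  exact haar_setOf_dist1_mem_eq_zero_specialUnitaryGroup (Set.countable_singleton r) (by simpa using hr.symm)

/-- **`dU{U | dist1(h⁻¹·U b) = r} = 0`** on `SU(N)`-configurations (product Haar measure `fieldMeasure`, every torus and level): the preimage under the
`b`-th coordinate of a null set is null (Mathlib `Measure.pi_eval_preimage_null`). [cite: Balaban1985Averaging, (10) p.19 and (19) p.21] -/
theorem fieldMeasure_setOf_dist1_inv_mul_apply_eq_eq_zero {P : Params} {j : ℕ} (b : PBond P j) (h : SU N) {r : ℝ} (hr : r ≠ 0) :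
    fieldMeasure P j (SU N) {U : GaugeField P j (SU N) | dist1 (h⁻¹ * U b) = r} = 0 := by
  haveI : IsProbabilityMeasure (HaarData.haar : Measure (SU N)) := HaarData.isProb
  show Measure.pi (fun _ : PBond P j => (HaarData.haar : Measure (SU N)))
      (Function.eval b ⁻¹' {g : SU N | dist1 (h⁻¹ * g) = r}) = 0
  exact Measure.pi_eval_preimage_null _ (haar_setOf_dist1_inv_mul_eq_eq_zero h hr)

/-- **HAAR-FREE MAPS**: if `π : Z → SU(N)` is measurable with `π_*τ ≪ Haar`, then `τ{z | dist1(h⁻¹·π z) = r} = 0` for `r ≠ 0`.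
[cite: Balaban1985Averaging, (19) p.21] [cite: BrockerTomDieck1985, IV (2.11) (proof)] -/
theorem measure_setOf_dist1_inv_mul_comp_eq_eq_zero_of_map_ac {Z : Type*} [MeasurableSpace Z] (τ : Measure Z) {π : Z → SU N}
    (hπ : Measurable π) (hac : τ.map π ≪ (HaarData.haar : Measure (SU N))) (h : SU N) {r : ℝ} (hr : r ≠ 0) :
    τ {z | dist1 (h⁻¹ * π z) = r} = 0 := by
  have hm : MeasurableSet {g : SU N | dist1 (h⁻¹ * g) = r} :=
    (RegularGaugeGroup.measurable_dist1.comp ((continuous_const.mul continuous_id).measurable)) (measurableSet_singleton r)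
  have heq : τ {z | dist1 (h⁻¹ * π z) = r} = τ.map π {g : SU N | dist1 (h⁻¹ * g) = r} := by
    rw [Measure.map_apply hπ hm]; rfl
  rw [heq]
  exact hac (haar_setOf_dist1_inv_mul_eq_eq_zero h hr)

end Spheres

/-! ## §2 At the record: the (2.9) deviation on the fibre; `hnull` for a Haar-free bond -/

section Record

variable {F : T4Family} {N : ℕ} [NeZero N]

/-- **ON THE FIBRE THE (2.9) DEVIATION IS A ONE-MATRIX FUNCTIONAL**: if `Ū(V) = V₀` then `fluctDev_k(V)(b) = dist1 (V^{(k)}(V₀)(b)⁻¹ · V b)` — the critical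
configuration of record `V^{(k)}(Ū)` ((2.3) p. 265) is constant along the fibre. [cite: Balaban1987RG1, (2.3) p.265 and (2.9) p.266] -/
theorem fluctDevOfRecord_eq_of_avg_eq (ν : Stage7Numerics) (K k : ℕ) {V : GaugeField (F.P K) k (SU N)}
    {V₀ : PBond (F.P K) (k + 1) → SU N} (h : (avOfRecord F N K k).avg V = V₀) (b : PBond (F.P K) k) :
    fluctDevOfRecord F N ν K k V b = dist1 ((critCfgOfRecord F N ν K k V₀ b)⁻¹ * V b) := by
  rw [fluctDevOfRecord_apply, h]

/-- ★★ **`hnull` FOR A CHART LEAVING THE BOND VARIABLE HAAR-FREE (one step, one coarse field, one bond).**  Any fibre measure space `(Z, τ)`, a chart `Φ` lying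
over `V₀` off a `τ`-null set, with `z ↦ Φ(V₀,z) b` measurable and its law `≪ Haar`: the exact-threshold set at `b` is `τ`-null for `ε₁ ≠ 0` (preimage of the
translated `dist1`-sphere centred at `V^{(k)}(V₀)(b)`). [cite: Balaban1987RG1, (2.9) p.266 and (2.10) p.267] [cite: Balaban1985Averaging, (19) p.21] -/
theorem hnull_of_haarFreeBond (ν : Stage7Numerics) (K k : ℕ) {Z : Type*} [MeasurableSpace Z] (τ : Measure Z)
    (Φ : (PBond (F.P K) (k + 1) → SU N) × Z → GaugeField (F.P K) k (SU N)) {V₀ : PBond (F.P K) (k + 1) → SU N} (b : PBond (F.P K) k)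
    {S : Set Z} (hS : τ Sᶜ = 0) (havg : ∀ z ∈ S, (avOfRecord F N K k).avg (Φ (V₀, z)) = V₀)
    (hπ : Measurable fun z => Φ (V₀, z) b) (hac : τ.map (fun z => Φ (V₀, z) b) ≪ (HaarData.haar : Measure (SU N)))
    {ε₁ : ℝ} (hε : ε₁ ≠ 0) :
    τ {z | fluctDevOfRecord F N ν K k (Φ (V₀, z)) b = ε₁} = 0 := by
  have key := measure_setOf_dist1_inv_mul_comp_eq_eq_zero_of_map_ac τ hπ hac (critCfgOfRecord F N ν K k V₀ b) hε
  refine measure_mono_null (fun z hz => ?_) (measure_union_null key hS)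
  by_cases hzS : z ∈ S
  · left
    show dist1 ((critCfgOfRecord F N ν K k V₀ b)⁻¹ * Φ (V₀, z) b) = ε₁
    rw [← fluctDevOfRecord_eq_of_avg_eq ν K k (havg z hzS) b]
    exact hz
  · exact Or.inr hzS

/-! ## §3 Road A′: the private-coordinate chart `extend centralBond …` and its χ-support re-basing — `hnull` outright -/

/-- ★★ **ROAD A′ (the private-coordinate chart of dag-n09-w6 g3) — `hnull` ON THE COARSE-WINDOW SUPPORT, OUTRIGHT.**  For the chart
`Φ(V₀,U) = extend centralBond (c ↦ ϑ c U (V₀ c)) U` of `…N09HregOfPerBondChartsAtRecord` (fibre space = the fine configurations, `τ = fieldMeasure`) with right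
inverses `ϑ c U` on coarse windows `T c U` (`hright`): at every NON-distinguished bond `b` (`¬IsB0 b`; the distinguished bonds `b₀(c)` of (2.9) ARE the central
bonds, so the chart leaves `U b` untouched) and every `ε₁ ≠ 0`, `dU{U | (∀ c, V₀ c ∈ T c U) ∧ fluctDev_j(Φ(V₀,U))(b) = ε₁} = 0` — no Jacobian, no measurability of
`ϑ`, no law. [cite: Balaban1987RG1, (2.9) p.266, (2.10) p.267 and (0.4) p.253] [cite: Balaban1985Averaging, (10) p.19 and (19) p.21] -/
theorem fieldMeasure_thresholdSet_extendCentralBond_eq_zero (ν : Stage7Numerics) {K j : ℕ} (hj : j < K) [DecidableEq (PBond (F.P K) j)]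
    (T : PBond (F.P K) (j + 1) → GaugeField (F.P K) j (SU N) → Set (SU N))
    (ϑ : PBond (F.P K) (j + 1) → GaugeField (F.P K) j (SU N) → SU N → SU N)
    (hright : ∀ c U, ∀ v ∈ T c U, (avOfRecord F N K j).avg (update U (centralBond c) (ϑ c U v)) c = v)
    (V₀ : PBond (F.P K) (j + 1) → SU N) {b : PBond (F.P K) j} (hb : ¬ IsB0 b) {ε₁ : ℝ} (hε : ε₁ ≠ 0) :
    fieldMeasure (F.P K) j (SU N) {U : GaugeField (F.P K) j (SU N) | (∀ c, V₀ c ∈ T c U) ∧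
      fluctDevOfRecord F N ν K j (extend centralBond (fun c => ϑ c U (V₀ c)) U) b = ε₁} = 0 := by
  have hnb : ¬ ∃ c : PBond (F.P K) (j + 1), centralBond c = b := fun ⟨c, hc⟩ => hb ⟨c, hc⟩
  refine measure_mono_null (fun U hU => ?_)
    (fieldMeasure_setOf_dist1_inv_mul_apply_eq_eq_zero (N := N) b (critCfgOfRecord F N ν K j V₀ b) hε)
  obtain ⟨hT, hdev⟩ := hU
  have havg : (avOfRecord F N K j).avg (extend centralBond (fun c => ϑ c U (V₀ c)) U) = V₀ :=
    apply_triChart_eq_of_forall_mem T ϑ (isLocal_avOfRecord hj) (centralBond_injective_record hj) hright hT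
  have hb' : (extend centralBond (fun c => ϑ c U (V₀ c)) U : GaugeField (F.P K) j (SU N)) b = U b :=
    Function.extend_apply' _ _ b hnb
  show dist1 ((critCfgOfRecord F N ν K j V₀ b)⁻¹ * U b) = ε₁
  rw [← hb', ← fluctDevOfRecord_eq_of_avg_eq ν K j havg b]
  exact hdev

/-- ★★ **… and on the Jacobian support** (the form `J(V₀,U) ≠ 0` in which road A′'s fibre integrand is non-trivial; `J = 𝟙[∀ c, V₀ c ∈ T c U]·∏ j_c`).
[cite: Balaban1987RG1, (2.9) p.266, (2.10) p.267 and (0.4) p.253] [cite: Balaban1985Averaging, (10) p.19 and (19) p.21] -/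
theorem fieldMeasure_thresholdSet_extendCentralBond_eq_zero_of_jacobian (ν : Stage7Numerics) {K j : ℕ} (hj : j < K)
    [DecidableEq (PBond (F.P K) j)]
    (T : PBond (F.P K) (j + 1) → GaugeField (F.P K) j (SU N) → Set (SU N))
    (ϑ : PBond (F.P K) (j + 1) → GaugeField (F.P K) j (SU N) → SU N → SU N)
    (jd : PBond (F.P K) (j + 1) → GaugeField (F.P K) j (SU N) → SU N → ℝ≥0)
    (hright : ∀ c U, ∀ v ∈ T c U, (avOfRecord F N K j).avg (update U (centralBond c) (ϑ c U v)) c = v)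
    (V₀ : PBond (F.P K) (j + 1) → SU N) {b : PBond (F.P K) j} (hb : ¬ IsB0 b) {ε₁ : ℝ} (hε : ε₁ ≠ 0) :
    fieldMeasure (F.P K) j (SU N) {U : GaugeField (F.P K) j (SU N) |
      {p : (PBond (F.P K) (j + 1) → SU N) × GaugeField (F.P K) j (SU N) | ∀ c, p.1 c ∈ T c p.2}.indicator
          (fun p => ∏ c, jd c p.2 (p.1 c)) (V₀, U) ≠ 0 ∧
        fluctDevOfRecord F N ν K j (extend centralBond (fun c => ϑ c U (V₀ c)) U) b = ε₁} = 0 := by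
  have hnb : ¬ ∃ c : PBond (F.P K) (j + 1), centralBond c = b := fun ⟨c, hc⟩ => hb ⟨c, hc⟩
  refine measure_mono_null (fun U hU => ?_)
    (fieldMeasure_setOf_dist1_inv_mul_apply_eq_eq_zero (N := N) b (critCfgOfRecord F N ν K j V₀ b) hε)
  obtain ⟨hJ, hdev⟩ := hU
  have havg : (avOfRecord F N K j).avg (extend centralBond (fun c => ϑ c U (V₀ c)) U) = V₀ :=
    avOfRecord_triChart_eq_of_jacobian_ne_zero T ϑ jd hj hright hJ
  have hb' : (extend centralBond (fun c => ϑ c U (V₀ c)) U : GaugeField (F.P K) j (SU N)) b = U b :=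
    Function.extend_apply' _ _ b hnb
  show dist1 ((critCfgOfRecord F N ν K j V₀ b)⁻¹ * U b) = ε₁
  rw [← hb', ← fluctDevOfRecord_eq_of_avg_eq ν K j havg b]
  exact hdev


/-- ★★★ **THE χ-SUPPORT RE-BASING OF THE ROAD-A′ CHART (dag-n09-w5 g4's tower chart) — `hnull` OVER ALL FINE CONFIGURATIONS.**  For ANY re-basing set `A` of
(coarse, fine) pairs on which the Jacobian `J = 𝟙[∀ c, · ∈ T c ·]·∏ j_c` is non-zero, the piecewise chart `Φ′ = A.piecewise Φ (V^{(j)} ∘ fst)` (fallback = the critical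
configuration of record) has `dU{U | fluctDev_j(Φ′(V₀,U))(b) = ε₁} = 0` at every non-distinguished `b` and every `ε₁ ≠ 0`, PROVIDED the fallback lies over `V₀`
(`Ū(V^{(j)}(V₀)) = V₀` — K0e's `avg_critCfgOfRecord` on the solvable set): on `A` it is the Jacobian-support form, off `A` the deviation is `dist1 1 = 0 ≠ ε₁`.
[cite: Balaban1987RG1, (2.3) p.265, (2.9) p.266, (2.10) p.267 and (0.4) p.253] [cite: Balaban1985Averaging, (10) p.19 and (19) p.21] -/
theorem fieldMeasure_thresholdSet_piecewise_extendCentralBond_eq_zero (ν : Stage7Numerics) {K j : ℕ} (hj : j < K)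
    [DecidableEq (PBond (F.P K) j)]
    (T : PBond (F.P K) (j + 1) → GaugeField (F.P K) j (SU N) → Set (SU N))
    (ϑ : PBond (F.P K) (j + 1) → GaugeField (F.P K) j (SU N) → SU N → SU N)
    (jd : PBond (F.P K) (j + 1) → GaugeField (F.P K) j (SU N) → SU N → ℝ≥0)
    (hright : ∀ c U, ∀ v ∈ T c U, (avOfRecord F N K j).avg (update U (centralBond c) (ϑ c U v)) c = v)
    (A : Set ((PBond (F.P K) (j + 1) → SU N) × GaugeField (F.P K) j (SU N))) [DecidablePred (· ∈ A)]
    (hA : A ⊆ {p | {p : (PBond (F.P K) (j + 1) → SU N) × GaugeField (F.P K) j (SU N) | ∀ c, p.1 c ∈ T c p.2}.indicator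
      (fun p => ∏ c, jd c p.2 (p.1 c)) p ≠ 0})
    {V₀ : PBond (F.P K) (j + 1) → SU N} (hV₀ : (avOfRecord F N K j).avg (critCfgOfRecord F N ν K j V₀) = V₀)
    {b : PBond (F.P K) j} (hb : ¬ IsB0 b) {ε₁ : ℝ} (hε : ε₁ ≠ 0) :
    fieldMeasure (F.P K) j (SU N) {U : GaugeField (F.P K) j (SU N) | fluctDevOfRecord F N ν K j
      (A.piecewise (fun p => (extend centralBond (fun c => ϑ c p.2 (p.1 c)) p.2 : GaugeField (F.P K) j (SU N)))
        (fun p => critCfgOfRecord F N ν K j p.1) (V₀, U)) b = ε₁} = 0 := by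
  refine measure_mono_null (fun U hU => ?_)
    (fieldMeasure_thresholdSet_extendCentralBond_eq_zero_of_jacobian ν hj T ϑ jd hright V₀ hb hε)
  by_cases hUA : (V₀, U) ∈ A
  · refine ⟨hA hUA, ?_⟩
    have h := hU
    simp only [mem_setOf_eq, Set.piecewise_eq_of_mem _ _ _ hUA] at h
    exact h
  · exfalso
    have h := hU
    simp only [mem_setOf_eq, Set.piecewise_eq_of_notMem _ _ _ hUA] at h
    rw [fluctDevOfRecord_eq_of_avg_eq ν K j hV₀ b, inv_mul_cancel, GaugeGroup.dist1_one] at h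
    exact hε h.symm

/-- ★★★ **THE (F1) TOWER'S BINDER `hnull` AT THE RE-BASED ROAD-A′ CHARTS, ALL STEPS** (dag-n09-w1 g5's shape `∀ j < K, ∀ V₀ ∈ domAlt_{j+1}, ∀ b, ¬IsB0 b → τ j {…} = 0`
with `Z j :=` the step-`j` configurations, `τ j := fieldMeasure`, `Φ′ j := (A j).piecewise Φ_j (V^{(j)} ∘ fst)`): from per-step inversion data `(T, ϑ, jd; hright)`, re-basing sets
`A j` inside the Jacobian supports, [B11] solvability `hsolν` on the domains (so that the fallback `V^{(j)}(V₀)` lies over `V₀`, `avg_critCfgOfRecord`) and `0 < ε₁`.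
The inversions and `hsolν` are displayed, not constructed. [cite: Balaban1987RG1, (2.3) p.265, (2.9) p.266 and (2.10) p.267] [cite: Balaban1985Variational, Thm 1 p.279] -/
theorem hnull_towerChart_of_perBondCharts (ν : Stage7Numerics) (K : ℕ) [∀ j, DecidableEq (PBond (F.P K) j)]
    (T : ∀ j, PBond (F.P K) (j + 1) → GaugeField (F.P K) j (SU N) → Set (SU N))
    (ϑ : ∀ j, PBond (F.P K) (j + 1) → GaugeField (F.P K) j (SU N) → SU N → SU N)
    (jd : ∀ j, PBond (F.P K) (j + 1) → GaugeField (F.P K) j (SU N) → SU N → ℝ≥0)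
    (hright : ∀ j < K, ∀ c U, ∀ v ∈ T j c U, (avOfRecord F N K j).avg (update U (centralBond c) (ϑ j c U v)) c = v)
    (A : ∀ j, Set ((PBond (F.P K) (j + 1) → SU N) × GaugeField (F.P K) j (SU N))) [∀ j, DecidablePred (· ∈ A j)]
    (hA : ∀ j < K, A j ⊆ {p | {p : (PBond (F.P K) (j + 1) → SU N) × GaugeField (F.P K) j (SU N) | ∀ c, p.1 c ∈ T j c p.2}.indicator
      (fun p => ∏ c, jd j c p.2 (p.1 c)) p ≠ 0})
    (hsolν : ∀ j < K, ∀ W ∈ domAltOfRecord F N ν K (j + 1), UkExists F N K (j + 1) ν.εreg W)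
    {ε₁ : ℝ} (hε : 0 < ε₁) :
    ∀ j < K, ∀ V₀ ∈ domAltOfRecord F N ν K (j + 1), ∀ b : PBond (F.P K) j, ¬ IsB0 b →
      fieldMeasure (F.P K) j (SU N) {U : GaugeField (F.P K) j (SU N) | fluctDevOfRecord F N ν K j
        ((A j).piecewise (fun p => (extend centralBond (fun c => ϑ j c p.2 (p.1 c)) p.2 : GaugeField (F.P K) j (SU N)))
          (fun p => critCfgOfRecord F N ν K j p.1) (V₀, U)) b = ε₁} = 0 :=
  fun j hj V₀ hV₀ _ hb =>
    fieldMeasure_thresholdSet_piecewise_extendCentralBond_eq_zero ν hj (T j) (ϑ j) (jd j) (hright j hj) (A j) (hA j hj)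
      (avg_critCfgOfRecord (hsolν j hj V₀ hV₀)) hb hε.ne'

end Record

end Summit.QuantumFields.YangMills.BalabanUVNodes.N09FibreThresholdNullOfCharts

end
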